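import Literature.NumberTheory.EllipticCurves.KubertTateFiveSelmerTameGaussian
import Mathlib.NumberTheory.NumberField.Cyclotomic.PID
import HarnessLib

/-!
# `Sel^φ(E_{m,n}/ℚ(ζ₃)) = 0` for the Kubert–Tate `5`-torsion family over the Eisenstein field in the
# tame régime (the `φ`-side of the `5`-descent over `ℚ(√-3)`, class-wide, no named fact)

PROOF-ONLY file (theorems only, no definition, no named fact, no `sorry`), topic
`NumberTheory/EllipticCurves`; the Eisenstein twin of the tree's `KubertTateFiveSelmerTameGaussian`
(`ℚ(i)`).  Base field `K = ℚ(ζ₃) = ℚ(√-3)` (any `K` with `IsCyclotomicExtension {3} ℚ K`; `𝓞 K = ℤ[ζ₃]`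
principal — Mathlib `IsCyclotomicExtension.Rat.three_pid` —, no real place).  Mazur's étale-kernel descent
over a number field (`ConstantKernelIsogenySelmerTrivialNumberField.selmerGroup_eq_bot_of_classNumber_eq_one`,
on the PROVED cyclic Hilbert class field) kills the `φ`-Selmer group of Vélu's `5`-isogeny
`φ : E_{m,n} → E_{m,n}/⟨(0,0)⟩`, `E_{m,n} = [n-m, -mn, -mn², 0, 0]`, as soon as every finite place is étale or
tame.  The tame condition is read through the splitting law of `ℤ[ζ₃]` (Mathlib
`IsCyclotomicExtension.Rat.inertiaDeg_eq_of_not_dvd`: a prime `𝔭 ∣ ℓ ≠ 3` of `ℤ[ζ₃]` has `N𝔭 = ℓ^{ord₃ ℓ}`,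
and `N𝔭 ∣ ℓ²` always): `gcd(5, N𝔭 - 1) = 1` iff `ℓ ≢ 1 (mod 5)` and, when `ℓ ≡ 4 (mod 5)`, `ℓ` splits
(`ℓ ≡ 1 (mod 3)`).

* §1 `residueCard_eq_pow_orderOf_three`, `residueCard_eq_of_mod_three_eq_one` — `N𝔭 = ℓ^{ord₃ ℓ}` for
  `ℓ ≠ 3`, `N𝔭 = ℓ` for `ℓ ≡ 1 (mod 3)`, for a finite place `𝔭 ∋ ℓ` of `ℚ(ζ₃)`.
* §2 `etale_or_tame_eisenstein` — every finite place of `ℚ(ζ₃)` is étale (`Δ(E_{m,n}) ∉ 𝔭`) or tame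
  (`5 ∉ 𝔭`, `gcd(5, N𝔭 - 1) = 1`) when `5 ∤ Δ` and every prime `ℓ ∣ Δ` has `ℓ ≢ 1 (mod 5)` and
  (`ℓ ≡ 4 (mod 5) ⇒ ℓ ≡ 1 (mod 3)`) — the EISENSTEIN TAME RÉGIME.
* §3 **`selmerGroup_fiveIsogeny_eq_bot_eisenstein`** — `Sel^φ(E_{m,n}/ℚ(ζ₃)) = 0` in that régime; hence
  `E'_{m,n}(ℚ(ζ₃)) = φ(E_{m,n}(ℚ(ζ₃)))` (`exists_toGeomPoints_eq_eisenstein`) and `Ш(E_{m,n}/ℚ(ζ₃))[φ] = 0`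
  (`ker_shaMap_fiveIsogeny_eq_bot_eisenstein`).
* §4 the instance `(m, n) = (37, 3)` (`E_{37/3} = [-34,-111,-333,0,0]`, `Δ = 3⁵·37⁵·139`, bad primes
  `3, 37, 139 ≡ 3, 2, 4 (mod 5)`, `139 ≡ 1 (mod 3)` split in `ℤ[ζ₃]`): `selmerGroup_fiveIsogeny_eq_bot_eisenstein_37_3`.

Why (stmt-BirchSwinnertonDyer-22356, «T = FiniteShaComponentTransfer»): with the `μ₅`-side box over `ℚ(ζ₃)`
this gives `rank E_{m,n}(ℚ(ζ₃)) + t₅ + 1 ≤ #{𝔭 ∣ mn}` and, since `Sel₅(E/ℚ(ζ₃)) = Sel₅(E/ℚ) ⊕ Sel₅(E^{(-3)}/ℚ)`,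
the door at `5` on the quadratic twists `E_{m,n}^{(-3)}` — curves WITHOUT rational `5`-torsion at which
`5` is INERT in the twisting field, so `a₅(E^{(-3)}) = -a₅(E) ≡ -1 (mod 5)`: the NON-anomalous Eisenstein
prime of Castella–Grossi–Lee–Skinner's `p`-converse (Theorem E), unlike the anomalous Gaussian twists.
BSD and T are NOT proved by any of this.

## References

* [Mazur1977] B. Mazur, *Modular curves and the Eisenstein ideal*, Publ. Math. IHÉS 47 (1977),
  Ch. III §3 Thm. (3.1), Ch. I §1(g).
* [Fisher2001FiveSevenDescent] T. Fisher, *Some examples of 5 and 7 descent for elliptic curves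
  over ℚ*, JEMS 3 (2001), §§1–2.
* [IrelandRosen1982] K. Ireland, M. Rosen, *A Classical Introduction to Modern Number Theory*,
  Ch. 9 §1 Prop. 9.1.4 (splitting in `ℤ[ω]`), Ch. 13 §2 Thm. 2 (splitting in cyclotomic fields).
* [SilvermanAEC2009] J. H. Silverman, *AEC*, 2nd ed., Thm. X.4.2.
* [NeukirchANT1999] J. Neukirch, *Algebraic Number Theory* (1999), Ch. I §8 Prop. (8.2), §10 (cyclotomic splitting).
-/

noncomputable section

open scoped Classical
open Polynomial WeierstrassCurve NumberField IsDedekindDomain Field Ideal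
open Literature.NumberTheory.EllipticCurves Literature.NumberTheory.GaloisRepresentations
  Literature.NumberTheory.NumberFields

namespace Literature.NumberTheory.EllipticCurves

namespace KubertTateVelu

/-! ## §1 Residue cardinalities of the finite places of `ℚ(ζ₃)` -/

section Places

variable {K : Type*} [Field K] [NumberField K] [IsCyclotomicExtension {3} ℚ K]

/-- A rational prime other than `3` does not divide `3`. [folklore] -/
private theorem not_dvd_three_of_prime_ne_three {ℓ : ℕ} (hℓ : ℓ.Prime) (hℓ3 : ℓ ≠ 3) : ¬ ℓ ∣ 3 :=
  fun h ↦ hℓ3 ((Nat.prime_dvd_prime_iff_eq hℓ Nat.prime_three).mp h)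

/-- **Splitting in `ℤ[ζ₃]`**: a finite place `v ∋ ℓ` of `ℚ(ζ₃)`, `ℓ ≠ 3`, has `N v = ℓ ^ ord₃(ℓ)`
(Mathlib's cyclotomic splitting law `IsCyclotomicExtension.Rat.inertiaDeg_eq_of_not_dvd`).
[cite: IrelandRosen1982, Ch. 13 §2 Thm. 2] -/
theorem residueCard_eq_pow_orderOf_three (v : HeightOneSpectrum (𝓞 K)) {ℓ : ℕ} (hℓ : ℓ.Prime)
    (hℓ3 : ℓ ≠ 3) (hℓv : (ℓ : 𝓞 K) ∈ v.asIdeal) : v.residueCard = ℓ ^ orderOf (ℓ : ZMod 3) := by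
  haveI := Fact.mk hℓ
  haveI := liesOver_span_of_natCast_mem v hℓ hℓv
  haveI : v.asIdeal.IsMaximal := v.isMaximal
  rw [residueCard_eq_pow_inertiaDeg' v hℓ hℓv, inertiaDeg'_eq_inertiaDeg (span {(ℓ : ℤ)}) v.asIdeal,
    IsCyclotomicExtension.Rat.inertiaDeg_eq_of_not_dvd ℓ K v.asIdeal (m := 3)
      (not_dvd_three_of_prime_ne_three hℓ hℓ3)]

/-- **Split primes**: for `ℓ ≡ 1 (mod 3)` every finite place `v ∋ ℓ` of `ℚ(ζ₃)` has `N v = ℓ`.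
[cite: IrelandRosen1982, Ch. 9 §1 Prop. 9.1.4] -/
theorem residueCard_eq_of_mod_three_eq_one (v : HeightOneSpectrum (𝓞 K)) {ℓ : ℕ} (hℓ : ℓ.Prime)
    (hℓ1 : ℓ % 3 = 1) (hℓv : (ℓ : 𝓞 K) ∈ v.asIdeal) : v.residueCard = ℓ := by
  have hℓ3 : ℓ ≠ 3 := by rintro rfl; norm_num at hℓ1
  have hord : orderOf (ℓ : ZMod 3) = 1 := by
    have hℓ' : (ℓ : ZMod 3) = 1 := by
      rw [← ZMod.natCast_mod ℓ 3, hℓ1]; rfl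
    rw [hℓ', orderOf_one]
  rw [residueCard_eq_pow_orderOf_three v hℓ hℓ3 hℓv, hord, pow_one]

/-- `[ℚ(ζ₃) : ℚ] = φ(3) = 2`. [folklore] -/
private theorem finrank_rat_three : Module.finrank ℚ K = 2 := by
  rw [IsCyclotomicExtension.finrank (n := 3) K (Polynomial.cyclotomic.irreducible_rat (by norm_num)),
    show Nat.totient 3 = 2 by decide]

/-- For any finite place `v ∋ ℓ` of `ℚ(ζ₃)`: `N v = ℓ` or `N v = ℓ²` (private: prints like its `ℚ(i)` twin).
[cite: NeukirchANT1999, Ch. I §8 Prop. (8.2)] -/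
private theorem residueCard_eq_or_eq_sq_three (v : HeightOneSpectrum (𝓞 K)) {ℓ : ℕ} (hℓ : ℓ.Prime)
    (hℓv : (ℓ : 𝓞 K) ∈ v.asIdeal) : v.residueCard = ℓ ∨ v.residueCard = ℓ ^ 2 := by
  obtain ⟨h1, h2⟩ := one_le_inertiaDeg'_le_finrank v hℓ hℓv
  rw [finrank_rat_three] at h2
  rw [residueCard_eq_pow_inertiaDeg' v hℓ hℓv]
  interval_cases (span {(ℓ : ℤ)}).inertiaDeg' v.asIdeal
  · left; rw [pow_one]
  · right; rfl

/-- `ℚ(ζ₃)` has no real place: `(2ζ₃ + 1)² = -3 < 0` (private: prints like its `ℚ(i)` twin).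
[cite: NeukirchANT1999, Ch. I §10] -/
private theorem isEmpty_ringHom_real_three : IsEmpty (K →+* ℝ) := by
  have hζ := IsCyclotomicExtension.zeta_spec 3 ℚ K
  have hroot := hζ.isRoot_cyclotomic (by norm_num)
  rw [Polynomial.cyclotomic_three, Polynomial.IsRoot.def] at hroot
  simp only [eval_add, eval_pow, eval_X, eval_one] at hroot
  refine isEmpty_ringHom_real_of_sq_eq (q := -3) (δ := 2 * IsCyclotomicExtension.zeta 3 ℚ K + 1)
    (by norm_num) ?_
  push_cast
  linear_combination (4 : K) * hroot

/-- `ℚ(ζ₃)` has class number one: `𝓞_{ℚ(ζ₃)} = ℤ[ζ₃]` is a principal ideal domain (Mathlib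
`IsCyclotomicExtension.Rat.three_pid`; private: prints like its `ℚ(i)` twin). [cite: NeukirchANT1999, Ch. I §3] -/
private theorem classNumber_eq_one_three : classNumber K = 1 := by
  haveI : IsPrincipalIdealRing (𝓞 K) := IsCyclotomicExtension.Rat.three_pid K
  exact classNumber_eq_one_iff.mpr inferInstance

end Places

/-! ## §2 The étale/tame hypothesis for `E_{m,n}` over `ℚ(ζ₃)` -/

section Eisenstein

variable {K : Type} [Field K] [NumberField K] [IsCyclotomicExtension {3} ℚ K]
variable (m n : ℤ) [hE : (kubertTateFive (m : K) (n : K)).IsElliptic]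

omit hE in
/-- **The étale/tame hypothesis over `ℚ(ζ₃)`, place by place (EISENSTEIN TAME RÉGIME).** If
`5 ∤ Δ(E_{m,n})` and every prime `ℓ ∣ Δ(E_{m,n})` satisfies `ℓ ≢ 1 (mod 5)` and
(`ℓ ≡ 4 (mod 5) ⇒ ℓ ≡ 1 (mod 3)`), then every finite place `v` of `ℚ(ζ₃)` has `Δ(E_{m,n}) ∉ v`, or
`5 ∉ v` and `gcd(5, N v - 1) = 1` (`N v = ℓ` for split `ℓ ≡ 1 (3)`, `N v ∈ {ℓ, ℓ²}` always;
`ℓ² ≡ 1 (mod 5)` iff `ℓ ≡ ±1`). [cite: Mazur1977, Ch. I §1(g)] [cite: IrelandRosen1982, Ch. 9 §1 Prop. 9.1.4] -/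
theorem etale_or_tame_eisenstein (h5 : ¬ (5 : ℤ) ∣ (kubertTateFive m n).Δ)
    (hbad : ∀ ℓ : ℕ, ℓ.Prime → (ℓ : ℤ) ∣ (kubertTateFive m n).Δ → ℓ % 5 ≠ 1 ∧ (ℓ % 5 = 4 → ℓ % 3 = 1))
    (v : HeightOneSpectrum (𝓞 K)) :
    (((kubertTateFive m n).Δ : ℤ) : 𝓞 K) ∉ v.asIdeal ∨
      (((5 : ℕ) : 𝓞 K) ∉ v.asIdeal ∧ Nat.Coprime 5 (v.residueCard - 1)) := by
  obtain ⟨ℓ, hℓ, hℓv⟩ := exists_nat_prime_mem_asIdeal v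
  haveI := liesOver_span_of_natCast_mem v hℓ hℓv
  by_cases hdvd : (ℓ : ℤ) ∣ (kubertTateFive m n).Δ
  · right
    obtain ⟨hℓ5, hℓ3⟩ := hbad ℓ hℓ hdvd
    have hℓne5 : ℓ ≠ 5 := by
      rintro rfl; exact h5 (by exact_mod_cast hdvd)
    constructor
    · -- `5 ∉ v`: otherwise `1 = aℓ + 5b ∈ v`
      intro h5v
      have hcop : Nat.Coprime ℓ 5 := (Nat.coprime_primes hℓ Nat.prime_five).mpr hℓne5
      obtain ⟨a, b, hab⟩ := Nat.isCoprime_iff_coprime.mpr hcop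
      have hab' : a * (ℓ : ℤ) + b * 5 = 1 := by exact_mod_cast hab
      apply v.isPrime.ne_top
      rw [Ideal.eq_top_iff_one]
      have h1 : ((a * ℓ + b * 5 : ℤ) : 𝓞 K) = 1 := by rw [hab']; norm_num
      rw [← h1]
      push_cast
      exact v.asIdeal.add_mem (v.asIdeal.mul_mem_left _ hℓv)
        (v.asIdeal.mul_mem_left _ (by exact_mod_cast h5v))
    · -- `gcd(5, N v - 1) = 1`
      rw [Nat.Prime.coprime_iff_not_dvd Nat.prime_five]
      have hℓmod : ℓ % 5 = 2 ∨ ℓ % 5 = 3 ∨ ℓ % 5 = 4 := by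
        have h0 : ℓ % 5 ≠ 0 := fun h0 ↦ by
          have : 5 ∣ ℓ := Nat.dvd_of_mod_eq_zero h0
          exact hℓne5 ((Nat.prime_dvd_prime_iff_eq Nat.prime_five hℓ).mp this).symm
        omega
      rcases hℓmod with h2 | h3 | h4
      · rcases residueCard_eq_or_eq_sq_three v hℓ hℓv with hN | hN <;> rw [hN]
        · omega
        · have : ℓ ^ 2 % 5 = 4 := by rw [Nat.pow_mod, h2]
          omega
      · rcases residueCard_eq_or_eq_sq_three v hℓ hℓv with hN | hN <;> rw [hN]
        · omega
        · have : ℓ ^ 2 % 5 = 4 := by rw [Nat.pow_mod, h3]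
          omega
      · rw [residueCard_eq_of_mod_three_eq_one v hℓ (hℓ3 h4) hℓv]
        omega
  · left
    intro hΔ
    apply hdvd
    have h := (mem_of_liesOver v.asIdeal (span {(ℓ : ℤ)}) ((kubertTateFive m n).Δ)).mpr
      (by simpa using hΔ)
    exact mem_span_singleton.mp h

/-! ## §3 `Sel^φ(E_{m,n}/ℚ(ζ₃)) = 0` and its consequences -/

/-- **`Sel^φ(E_{m,n}/ℚ(ζ₃)) = 0` in the Eisenstein tame régime** (`m, n ∈ ℤ`, `E_{m,n}` elliptic,
`5 ∤ Δ(E_{m,n})`, every prime `ℓ ∣ Δ` with `ℓ ≢ 1 (mod 5)` and `ℓ ≡ 4 (mod 5) ⇒ ℓ ≡ 1 (mod 3)`): the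
`ℤ/5`-side of the `5`-descent of `E_{m,n}` over `ℚ(ζ₃)` is empty — Mazur's étale-kernel descent over
the number field `ℚ(ζ₃)` (`ConstantKernelDescent.selmerGroup_eq_bot_of_classNumber_eq_one`: kernel
constant, cyclic and integral, every place étale or tame, `h(ℚ(ζ₃)) = 1`, no real place).
[cite: Mazur1977, Ch. III §3 Thm. (3.1) with Ch. I §1(g)] [cite: Fisher2001FiveSevenDescent, §§1–2] -/
theorem selmerGroup_fiveIsogeny_eq_bot_eisenstein (h5 : ¬ (5 : ℤ) ∣ (kubertTateFive m n).Δ)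
    (hbad : ∀ ℓ : ℕ, ℓ.Prime → (ℓ : ℤ) ∣ (kubertTateFive m n).Δ → ℓ % 5 ≠ 1 ∧ (ℓ % 5 = 4 → ℓ % 3 = 1)) :
    (fiveIsogeny (m : K) (n : K)).selmerGroup = ⊥ := by
  haveI : Fact (Nat.Prime 5) := ⟨Nat.prime_five⟩
  haveI : IsAddCyclic (fiveIsogeny (m : K) (n : K)).toAddMonoidHom.ker :=
    isAddCyclic_of_prime_card (p := 5) (natCard_ker_fiveIsogeny (m : K) (n : K))
  exact ConstantKernelDescent.selmerGroup_eq_bot_of_classNumber_eq_one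
    (fiveIsogeny (m : K) (n : K)) isEmpty_ringHom_real_three classNumber_eq_one_three
    (kubertTateFive m n) (eq_map_int_of_field m n)
    (fun σ P hP ↦ smul_eq_of_mem_ker (m : K) (n : K) σ P hP) (exists_int_of_mem_ker_of_field m n)
    (n := 5) (by norm_num) (fun P hP ↦ five_nsmul_eq_zero_of_mem_ker (m : K) (n : K) hP)
    (etale_or_tame_eisenstein m n h5 hbad)

/-- **`E'_{m,n}(ℚ(ζ₃)) = φ(E_{m,n}(ℚ(ζ₃)))` in the Eisenstein tame régime.** [cite: SilvermanAEC2009, Thm. X.4.2(a)] -/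
theorem exists_toGeomPoints_eq_eisenstein (h5 : ¬ (5 : ℤ) ∣ (kubertTateFive m n).Δ)
    (hbad : ∀ ℓ : ℕ, ℓ.Prime → (ℓ : ℤ) ∣ (kubertTateFive m n).Δ → ℓ % 5 ≠ 1 ∧ (ℓ % 5 = 4 → ℓ % 3 = 1))
    (P' : (kubertTateFive' (m : K) (n : K)).toAffine.Point) :
    ∃ P : (kubertTateFive (m : K) (n : K)).toAffine.Point,
      (kubertTateFive' (m : K) (n : K)).toGeomPoints P' =
        fiveIsogeny (m : K) (n : K) ((kubertTateFive (m : K) (n : K)).toGeomPoints P) :=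
  ConstantKernelDescent.exists_toGeomPoints_eq_of_selmerGroup_eq_bot (fiveIsogeny (m : K) (n : K))
    (selmerGroup_fiveIsogeny_eq_bot_eisenstein m n h5 hbad) P'

/-- **`Ш(E_{m,n}/ℚ(ζ₃))[φ] = 0` in the Eisenstein tame régime.** [cite: SilvermanAEC2009, Thm. X.4.2(a)] -/
theorem ker_shaMap_fiveIsogeny_eq_bot_eisenstein (h5 : ¬ (5 : ℤ) ∣ (kubertTateFive m n).Δ)
    (hbad : ∀ ℓ : ℕ, ℓ.Prime → (ℓ : ℤ) ∣ (kubertTateFive m n).Δ → ℓ % 5 ≠ 1 ∧ (ℓ % 5 = 4 → ℓ % 3 = 1)) :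
    (shaMap (fiveIsogeny (m : K) (n : K)).toAddMonoidHom (fiveIsogeny (m : K) (n : K)).equivariant
      (fiveIsogeny (m : K) (n : K)).hasLocalPointsMaps_toAddMonoidHom).ker = ⊥ :=
  ConstantKernelDescent.ker_shaMap_eq_bot_of_selmerGroup_eq_bot (fiveIsogeny (m : K) (n : K))
    (selmerGroup_fiveIsogeny_eq_bot_eisenstein m n h5 hbad)

end Eisenstein

/-! ## §4 The instance `(m, n) = (37, 3)` over `ℚ(ζ₃)` -/

section Instance373

variable {K : Type} [Field K] [NumberField K] [IsCyclotomicExtension {3} ℚ K]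

omit [IsCyclotomicExtension {3} ℚ K] in
/-- `E_{37/3} ⊗ ℚ(ζ₃) = [-34, -111, -333, 0, 0]` is elliptic: `Δ = 3⁵·37⁵·139 ≠ 0`.
[cite: Kubert1976, Table 3 (N = 5)] -/
theorem isElliptic_37_3_eisenstein : (kubertTateFive ((37 : ℤ) : K) ((3 : ℤ) : K)).IsElliptic := by
  refine ⟨isUnit_iff_ne_zero.mpr ?_⟩
  rw [eq_map_int_of_field (K := K) 37 3, map_Δ, kubertTateFive_Δ]
  norm_num

/-- **Eisenstein tameness of `E_{37/3}`**: `5 ∤ Δ = 3⁵·37⁵·139` and the bad primes `3, 37, 139` are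
`≡ 3, 2, 4 (mod 5)`, with `139 ≡ 1 (mod 3)` (split in `ℤ[ζ₃]`). [cite: Fisher2001FiveSevenDescent, §2] -/
theorem eisenstein_tame_37_3 :
    ¬ (5 : ℤ) ∣ (kubertTateFive (37 : ℤ) 3).Δ ∧
    ∀ ℓ : ℕ, ℓ.Prime → (ℓ : ℤ) ∣ (kubertTateFive (37 : ℤ) 3).Δ → ℓ % 5 ≠ 1 ∧ (ℓ % 5 = 4 → ℓ % 3 = 1) := by
  refine ⟨by rw [kubertTateFive_Δ]; norm_num, fun p hp hdvd ↦ ?_⟩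
  rw [kubertTateFive_Δ] at hdvd
  norm_num at hdvd
  -- `Δ = 2342230835589 = 3⁵·37⁵·139`
  have h139 : Nat.Prime 139 := by norm_num
  have h37 : Nat.Prime 37 := by norm_num
  have hdvdN : p ∣ 3 ^ 5 * 37 ^ 5 * 139 := by
    have h' : (p : ℤ) ∣ ((3 ^ 5 * 37 ^ 5 * 139 : ℕ) : ℤ) := by
      have e : ((3 ^ 5 * 37 ^ 5 * 139 : ℕ) : ℤ) = 2342230835589 := by norm_num
      rw [e]; exact hdvd
    exact Int.natCast_dvd_natCast.mp h'
  have hpi := Nat.Prime.prime hp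
  rcases hpi.dvd_or_dvd hdvdN with h | h
  · rcases hpi.dvd_or_dvd h with h | h
    · have := (Nat.prime_dvd_prime_iff_eq hp Nat.prime_three).mp (hpi.dvd_of_dvd_pow h); omega
    · have := (Nat.prime_dvd_prime_iff_eq hp h37).mp (hpi.dvd_of_dvd_pow h); omega
  · have := (Nat.prime_dvd_prime_iff_eq hp h139).mp h; omega

/-- **The instance `(m, n) = (37, 3)` over `ℚ(ζ₃)`**: `Sel^φ(E_{37/3}/ℚ(ζ₃)) = 0`.
[cite: Mazur1977, Ch. III §3 Thm. (3.1)] [cite: Fisher2001FiveSevenDescent, §§1–2] -/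
theorem selmerGroup_fiveIsogeny_eq_bot_eisenstein_37_3 :
    haveI := isElliptic_37_3_eisenstein (K := K)
    (fiveIsogeny ((37 : ℤ) : K) ((3 : ℤ) : K)).selmerGroup = ⊥ := by
  haveI := isElliptic_37_3_eisenstein (K := K)
  exact selmerGroup_fiveIsogeny_eq_bot_eisenstein (K := K) 37 3 eisenstein_tame_37_3.1
    eisenstein_tame_37_3.2

end Instance373

end KubertTateVelu

end Literature.NumberTheory.EllipticCurves

end
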